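import Literature.NumberTheory.Automorphic.UnitaryGroupUnipotentTermTwo
import Literature.NumberTheory.Automorphic.UnitaryGroupLineTorusPushGuardedTwo
import HarnessLib

/-!
# The unipotent term of `U(J₂)` from the torus normal form — CONSTANTS FIRST
(Rogawski, *Automorphic Representations of Unitary Groups in Three Variables* (1990), Prop. 7.3.1 (p. 97); Prop. 7.2.2 (pp. 94–95); Arthur,
*The trace formula in invariant form*, Ann. of Math. 114 (1981), Prop. 2.3.)

Topic `NumberTheory/Automorphic`; namespace `Literature.NumberTheory.Automorphic.UnitaryGroup`. THEOREMS ONLY over accepted tree modules (no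
definition, no named fact, no instance, no notation, no `sorry`). H-side item (σ-u) «per-class TATE ASSEMBLY, constants first» of the T1-qs LAW 5
road of `Cruxes/H413/Lines/F0_T1InnerFormTraceIdentity.lean` (cell `pub/hodgecm-mathlib`, crux H413; census `CENSUS-LAWS-Hside` §3 (σ-u)): the
companion of ★ `truncatedTraceClass_central_eq_linear_of_normalForm_two` (`UnitaryGroupUnipotentTermTwo`, same road: ★ B1_two ∘ ★ (C-G)_two ∘
the push) in which the two scalars — `Cg > 0` of ★ (C-G)_two `exists_weight_torus_kAverage_of_unipotent_invariant_two` (depends on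
`ν_G, μ_B, μ_K, μ_T, μ_N`, the Iwasawa data, `Ω`, `w_T` only) and the push constant `Cp ∈ (0, ∞)` of ★ B-p10
`exists_pushConst_forall_lineTorusStage_eq_linear_two′` (`UnitaryGroupLineTorusPushGuardedTwo`, the GUARDED normal form `∀ T, 0 < T → …`; depends on `δ, θ₀, μ_T, μ_A, ν_F` only) — are bound
ONCE, before the class key `ζ ∈ E¹`, the class map, the test function and the normal form `hΘ`: «one global Haar scalar before the class sums»,
the shape consumed by the socket closer ★ `exists_rep_sum_filter_central_classPolynomial_eval_zero_two` (`UnitaryGroupCentralSocketClosedTwo`).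

* **`exists_const_forall_truncatedTraceClass_central_eq_linear_of_normalForm_two`** — `∃ Cg > 0, ∃ Cp ≠ 0, ⊤, ∀ ζ z₁ cl … f … (hkint) (hint) φ H₁ V₀ (hΘ),
  ∃ T₂, ∀ T > T₂, J^T_𝔬(f) = c_μ·𝔄·log T + (μ(X)·f(z₁) + c_μ·𝔅)` with `𝔄 = Cg μ_N(Ω) V₀ Cp · ½ V · μ_A(D_F)⁻¹ 𝔉φ(0)` and `𝔅` the spelled Tate
  constants [Prop. 7.3.1 (a)–(d)], `log(T∕H₁)` expanded.

## References
* J. D. Rogawski, *Automorphic Representations of Unitary Groups in Three Variables*, Annals of Mathematics Studies 123 (1990), Prop. 7.3.1 (p. 97),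
  Prop. 7.2.2 (pp. 94–95) [Rogawski1990].
* J. Arthur, *The trace formula in invariant form*, Ann. of Math. 114 (1981), Prop. 2.3 [Arthur1981TraceFormulaInvariantForm].
* J. Tate, *Fourier analysis in number fields and Hecke's zeta-functions* (1967), Thm. 4.1.3 [CasselsFrohlichANT1967].
-/

set_option autoImplicit false

noncomputable section

open MeasureTheory MeasureTheory.Measure NumberField IsDedekindDomain Set Filter Polynomial Function Literature.MeasureTheory.Group
open scoped MatrixGroups NNReal ENNReal
open Literature.NumberTheory.Automorphic.Meyer
open Literature.NumberTheory.QuadraticForms (normIdeles)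
open Literature.NumberTheory.GaloisRepresentations (quadraticArtinIndicator)

namespace Literature.NumberTheory.Automorphic

namespace UnitaryGroup

variable {F E : Type} [Field F] [NumberField F] [Field E] [NumberField E] [Algebra F E]
  [Algebra.IsQuadraticExtension F E] {c : E ≃ₐ[F] E} {ι : Type*}
  [MeasurableSpace (adelicUnipotent F E c 2)] [BorelSpace (adelicUnipotent F E c 2)]
  [MeasurableSpace (quasiSplit F E c 2).Adelic] [BorelSpace (quasiSplit F E c 2).Adelic]
  [MeasurableSpace (AdeleRing (𝓞 F) F)] [BorelSpace (AdeleRing (𝓞 F) F)]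
  [MeasurableSpace (GaloisRepresentations.ideleGroup F)] [BorelSpace (GaloisRepresentations.ideleGroup F)]

/-- **ASSEMBLY OF THE UNIPOTENT TERM OF `U(J₂)` FROM THE TORUS NORMAL FORM, CONSTANTS FIRST** [Rogawski1990, Prop. 7.3.1 (p. 97)]: for the
quasi-split `U(J₂)` of `E∕F`, Haar data `ν, 𝓕` of `N(𝔸_F)`, an automorphic measure `μ`, an inversion-invariant Haar measure `ν_G`, a covering weight
`β` of `B(F)♯`, the Iwasawa∕torus data of ★ (C-G)_two and the line∕Tate data of the push: there are `Cg > 0` and `Cp ∈ (0, ∞)` such that FOR EVERY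
key `ζ ∈ E¹` (rational centre `z₁`), class map `cl` with central fibre `{charpoly = (X − ζ)²}` at `i`, `f ∈ C_c(G(𝔸_F))` with LAW 3 `hkint` and
(HINT) `hint`, line profile `φ ∈ 𝒮(𝔸_F)`, `H₁ > 0`, `V₀`, and GUARDED torus normal form `hΘ` (`∀ T, 0 < T → …` — at `T = 0` the normal form is unsatisfiable for the bracket, p04 (g7)): `J^T_𝔬(f) = c_μ·𝔄·log T + (μ(X)·f(z₁) + c_μ·𝔅)` for `T ≫ 0` with
`𝔄 = Cg μ_N(Ω) V₀ Cp · ½ V · μ_A(D_F)⁻¹ 𝔉φ(0)` [(d) the `J^T_M` slope] and `𝔅` = (b) the `ω_{E∕F}` Tate integrals + (c) `A + cÂ − Vφ(0)` + the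
`−log H₁` shift [(a) = `μ(X) f(z₁)`]. [cite: Rogawski1990, Prop. 7.3.1 (p. 97)] [cite: Rogawski1990, Prop. 7.2.2 (pp. 94–95)]
[cite: Arthur1981TraceFormulaInvariantForm, Prop. 2.3] -/
theorem exists_const_forall_truncatedTraceClass_central_eq_linear_of_normalForm_two
    (hc : c * c = 1) (hc1 : c ≠ 1)
    (ν : Measure (adelicUnipotent F E c 2)) [ν.IsHaarMeasure]
    {𝓕 : Set (adelicUnipotent F E c 2)} (h𝓕 : IsFundamentalDomain (rationalUnipotent F E c 2) 𝓕 ν)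
    (μ : Measure (quasiSplit F E c 2).automorphicQuotient) [(quasiSplit F E c 2).IsAutomorphicMeasure μ]
    (νG : Measure (quasiSplit F E c 2).Adelic) [νG.IsHaarMeasure] [νG.IsInvInvariant]
    {β : (quasiSplit F E c 2).Adelic → ℝ≥0∞}
    (hβ : IsCoveringWeight ((arithmeticBorel F E c 2).map (quasiSplit F E c 2).arithmeticSubgroup.subtype) β)
    -- the Iwasawa ∕ torus data of (C-G)_two
    (μB : Measure (borelAdelic F E c 2)) [μB.IsHaarMeasure]
    (μK : Measure ((standardMaximalCompactGL 2 E).comap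
      (adelicVal F E c 2 ((StdForm.antidiagonal 2).over E)) : Subgroup (quasiSplit F E c 2).Adelic))
    [μK.IsHaarMeasure]
    (μT : Measure (torusInBorel F E c 2)) [μT.IsHaarMeasure]
    (μN : Measure (unipotentInBorel F E c 2)) [μN.IsHaarMeasure]
    (hBK : ∀ g : (quasiSplit F E c 2).Adelic, ∃ b ∈ borelAdelic F E c 2, ∃ k : (quasiSplit F E c 2).Adelic,
      adelicVal F E c 2 ((StdForm.antidiagonal 2).over E) k ∈ standardMaximalCompactGL 2 E ∧ g = b * k)
    {Ω : Set (unipotentInBorel F E c 2)} (hΩ : MeasurableSet Ω)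
    (hΩu : ∀ n : unipotentInBorel F E c 2,
      ∃! ν : (((quasiSplit F E c 2).arithmeticSubgroup).subgroupOf (borelAdelic F E c 2)).subgroupOf
        (unipotentInBorel F E c 2), ν • n ∈ Ω)
    {wT : torusInBorel F E c 2 → ℝ≥0∞}
    (hwT : IsCoveringWeight ((((quasiSplit F E c 2).arithmeticSubgroup).subgroupOf (borelAdelic F E c 2)).subgroupOf
      (torusInBorel F E c 2)) wT)
    -- the line ∕ Tate data of the push
    {δ : E} (hcδ : c δ = -δ) (hδ : δ ≠ 0) (θ₀ : 𝓞 F) (hθ : θ₀ ≠ 0) (hd : δ * δ = algebraMap F E (θ₀ : F))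
    (hsq : ¬ IsSquare ((θ₀ : 𝓞 F) : F))
    (μA : Measure (AdeleRing (𝓞 F) F)) [μA.IsAddHaarMeasure]
    (νF : Measure (GaloisRepresentations.ideleGroup F)) [νF.IsHaarMeasure]
    {𝓕F : Set (GaloisRepresentations.ideleGroup F)} (h𝓕F : IsIdeleClassDomain F 𝓕F) :
    haveI := t2Space_adeleRing_of_numberField E
    haveI := locallyCompactSpace_adeleRing' E
    haveI := secondCountableTopology_adeleRing E
    haveI : T2Space (quasiSplit F E c 2).Adelic :=
      inferInstanceAs (T2Space (adelic F E c 2 ((StdForm.antidiagonal 2).over E)))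
    haveI : LocallyCompactSpace (quasiSplit F E c 2).Adelic :=
      inferInstanceAs (LocallyCompactSpace (adelic F E c 2 ((StdForm.antidiagonal 2).over E)))
    haveI : SecondCountableTopology (quasiSplit F E c 2).Adelic :=
      inferInstanceAs (SecondCountableTopology (adelic F E c 2 ((StdForm.antidiagonal 2).over E)))
    haveI : DiscreteTopology (quasiSplit F E c 2).quotientSubgroup := by
      rw [quotientSubgroup_quasiSplit]; exact isDiscreteRational_quasiSplit
    letI := AdelicGroupData.measurableSpaceQuotientForm (quasiSplit F E c 2)
    haveI := AdelicGroupData.borelSpaceQuotientForm (quasiSplit F E c 2)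
    haveI := AdelicGroupData.smulInvariantMeasureQuotientForm (quasiSplit F E c 2) μ
    haveI := AdelicGroupData.isFiniteMeasureOnCompactsQuotientForm (quasiSplit F E c 2) μ
    ∃ Cg : ℝ≥0, 0 < Cg ∧ ∃ Cp : ℝ≥0∞, Cp ≠ 0 ∧ Cp ≠ ∞ ∧
      ∀ (ζ : ratOne F E c) {z₁ : (quasiSplit F E c 2).arithmeticSubgroup} {cl : (quasiSplit F E c 2).arithmeticSubgroup → ι}
      (hz₁ : (z₁ : (quasiSplit F E c 2).Adelic) =
        (quasiSplit F E c 2).toAdelic (ratCenter F E c 2 ((StdForm.antidiagonal 2).over E) ζ))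
      {i : ι} (hcl : ∀ γ : (quasiSplit F E c 2).arithmeticSubgroup, cl γ = i ↔
        ((adelicVal F E c 2 _ (γ : (quasiSplit F E c 2).Adelic) : GL (Fin 2) (AdeleRing (𝓞 E) E)) :
            Matrix (Fin 2) (Fin 2) (AdeleRing (𝓞 E) E)).charpoly =
          ((X - C ((ζ : Eˣ) : E)) ^ 2).map (algebraMap E (AdeleRing (𝓞 E) E)))
      (hclN : IsUnipotentInvariantOnBorel F E c 2 cl)
      {f : (quasiSplit F E c 2).Adelic → ℂ} (hfc : Continuous f) (hf : HasCompactSupport f)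
      -- (i) LAW 3 and (ii) (HINT), threshold forms
      (hkint : ∃ T₀ : ℝ≥0, ∀ T : ℝ≥0, T₀ < T →
        Integrable ((quasiSplit F E c 2).quotFun (truncatedKernelClass ν 𝓕 T cl i f)) μ)
      (hint : ∃ Th : ℝ≥0, ∀ T : ℝ≥0, Th < T →
        Integrable ((quasiSplit F E c 2).quotFun (truncatedKernelClass ν 𝓕 T cl i f)) μ →
        ∫⁻ g, β g * ‖(∑' u : {u : rationalUnipotent F E c 2 // u ≠ 1},
          f (g⁻¹ * ((z₁ * ⟨(((u.1 : rationalUnipotent F E c 2) : adelicUnipotent F E c 2) : (quasiSplit F E c 2).Adelic),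
            (u.1 : rationalUnipotent F E c 2).2⟩ : (quasiSplit F E c 2).arithmeticSubgroup) : (quasiSplit F E c 2).Adelic) * g)) -
        kernelBorelTailClass ν 𝓕 T cl i f g‖ₑ ∂νG < ∞)
      {φ : AdeleRing (𝓞 F) F → ℂ} (hφ : φ ∈ schwartzBruhatAdele F) {H₁ : ℝ} (hH₁ : 0 < H₁) (V₀ : ℝ)
      -- (iii) the NORMAL FORM of the `K_U`-averaged bracket on the torus
      (hΘ : ∀ (T : ℝ≥0), 0 < (T : ℝ) → ∀ (t : torusInBorel F E c 2),
        ((torusRootModulus E 2 (diagUnit (t : borelAdelic F E c 2).2) : ℝ≥0) : ℝ)⁻¹ •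
            (∫ k, ((∑' u : {u : rationalUnipotent F E c 2 // u ≠ 1},
                f ((((t : borelAdelic F E c 2) : (quasiSplit F E c 2).Adelic) * (k : (quasiSplit F E c 2).Adelic))⁻¹ *
                  ((z₁ * ⟨(((u.1 : rationalUnipotent F E c 2) : adelicUnipotent F E c 2) : (quasiSplit F E c 2).Adelic),
                    (u.1 : rationalUnipotent F E c 2).2⟩ : (quasiSplit F E c 2).arithmeticSubgroup) : (quasiSplit F E c 2).Adelic) *
                    (((t : borelAdelic F E c 2) : (quasiSplit F E c 2).Adelic) * (k : (quasiSplit F E c 2).Adelic)))) -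
              kernelBorelTailClass ν 𝓕 T cl i f
                (((t : borelAdelic F E c 2) : (quasiSplit F E c 2).Adelic) * (k : (quasiSplit F E c 2).Adelic))) ∂μK) =
          (V₀ : ℂ) *
            ((ideleSum F φ (AdeleRing.ideleRelNorm F E (diagUnit (t : borelAdelic F E c 2).2 0))⁻¹ -
                ((IdeleClassGroup.ideleNorm F (AdeleRing.ideleRelNorm F E (diagUnit (t : borelAdelic F E c 2).2 0))⁻¹ : ℝ) : ℂ)⁻¹ *
                  {y : GaloisRepresentations.ideleGroup F |
                      (IdeleClassGroup.ideleNorm F y : ℝ) < ((T : ℝ) / H₁)⁻¹}.indicator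
                    (fun _ => ((μA (adeleFundamentalDomain F)).toReal⁻¹ : ℂ) * adeleFourier F μA φ 0)
                    (AdeleRing.ideleRelNorm F E (diagUnit (t : borelAdelic F E c 2).2 0))⁻¹) *
              ((IdeleClassGroup.ideleNorm F (AdeleRing.ideleRelNorm F E (diagUnit (t : borelAdelic F E c 2).2 0))⁻¹ : ℝ) : ℂ))),
        ∃ T₂ : ℝ≥0, ∀ T : ℝ≥0, T₂ < T →
        truncatedTraceClass μ ν 𝓕 T cl i f =
          ((unfoldingConstant (quasiSplit F E c 2).quotientSubgroup
              (count : Measure (quasiSplit F E c 2).quotientSubgroup) μ νG : ℝ) : ℂ) *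
              (((Cg : ℝ) : ℂ) * (μN.real Ω : ℂ) * (((V₀ : ℂ) * (Cp.toReal : ℂ)) *
                ((1 / 2 : ℂ) * (((idelicCovolume F νF).toReal : ℂ) *
                  (((μA (adeleFundamentalDomain F)).toReal⁻¹ : ℂ) * adeleFourier F μA φ 0))))) *
            ((Real.log (T : ℝ) : ℝ) : ℂ) +
          ((μ.real Set.univ : ℝ) • f (z₁ : (quasiSplit F E c 2).Adelic) +
            ((unfoldingConstant (quasiSplit F E c 2).quotientSubgroup
                (count : Measure (quasiSplit F E c 2).quotientSubgroup) μ νG : ℝ) : ℂ) *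
              (((Cg : ℝ) : ℂ) * (μN.real Ω : ℂ) * (((V₀ : ℂ) * (Cp.toReal : ℂ)) *
                ((1 / 2 : ℂ) * (-(((idelicCovolume F νF).toReal : ℂ) * ((Real.log H₁ : ℝ) : ℂ)) *
                      (((μA (adeleFundamentalDomain F)).toReal⁻¹ : ℂ) * adeleFourier F μA φ 0) +
                    ((∫ x in {x | 1 ≤ (IdeleClassGroup.ideleNorm F x : ℝ)} ∩ 𝓕F,
                        ideleSum F φ x * ((IdeleClassGroup.ideleNorm F x : ℝ) : ℂ) ∂νF) +
                      ((μA (adeleFundamentalDomain F)).toReal⁻¹ : ℂ) *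
                        (∫ x in {x | 1 ≤ (IdeleClassGroup.ideleNorm F x : ℝ)} ∩ 𝓕F,
                          ideleSum F (adeleFourier F μA φ) x ∂νF) -
                      ((idelicCovolume F νF).toReal : ℂ) * φ 0)) +
                  (1 / 2 : ℂ) * ((∫ x in {x | 1 ≤ (IdeleClassGroup.ideleNorm F x : ℝ)} ∩ 𝓕F,
                      ideleSum F φ x * (-1 : ℂ) ^ (quadraticArtinIndicator F ((θ₀ : 𝓞 F) : F) x).val *
                        ((IdeleClassGroup.ideleNorm F x : ℝ) : ℂ) ∂νF) +
                    ((μA (adeleFundamentalDomain F)).toReal⁻¹ : ℂ) *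
                      ∫ x in {x | 1 ≤ (IdeleClassGroup.ideleNorm F x : ℝ)} ∩ 𝓕F,
                        ideleSum F (adeleFourier F μA φ) x *
                          (-1 : ℂ) ^ (quadraticArtinIndicator F ((θ₀ : 𝓞 F) : F) x⁻¹).val ∂νF))))) := by
  haveI := t2Space_adeleRing_of_numberField E
  haveI := locallyCompactSpace_adeleRing' E
  haveI := secondCountableTopology_adeleRing E
  haveI : T2Space (quasiSplit F E c 2).Adelic :=
    inferInstanceAs (T2Space (adelic F E c 2 ((StdForm.antidiagonal 2).over E)))
  haveI : LocallyCompactSpace (quasiSplit F E c 2).Adelic :=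
    inferInstanceAs (LocallyCompactSpace (adelic F E c 2 ((StdForm.antidiagonal 2).over E)))
  haveI : SecondCountableTopology (quasiSplit F E c 2).Adelic :=
    inferInstanceAs (SecondCountableTopology (adelic F E c 2 ((StdForm.antidiagonal 2).over E)))
  haveI : DiscreteTopology (quasiSplit F E c 2).quotientSubgroup := by
    rw [quotientSubgroup_quasiSplit]; exact isDiscreteRational_quasiSplit
  letI := AdelicGroupData.measurableSpaceQuotientForm (quasiSplit F E c 2)
  haveI := AdelicGroupData.borelSpaceQuotientForm (quasiSplit F E c 2)
  haveI := AdelicGroupData.smulInvariantMeasureQuotientForm (quasiSplit F E c 2) μ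
  haveI := AdelicGroupData.isFiniteMeasureOnCompactsQuotientForm (quasiSplit F E c 2) μ
  -- the two GLOBAL constants: (C-G)_two and the push
  obtain ⟨Cg, hCg, -, hB⟩ :=
    exists_weight_torus_kAverage_of_unipotent_invariant_two hc hc1 νG μB μK μT μN hBK hΩ hΩu hwT
  obtain ⟨Cp, hCp0, hCpt, hpush⟩ :=
    exists_pushConst_forall_lineTorusStage_eq_linear_two' hc hcδ hδ θ₀ hθ hd hsq μT μA νF
  refine ⟨Cg, hCg, Cp, hCp0, hCpt, ?_⟩
  intro ζ z₁ cl hz₁ i hcl hclN f hfc hf hkint hint φ hφ H₁ hH₁ V₀ hΘ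
  obtain ⟨T₀, hT₀⟩ := hkint
  obtain ⟨Th, hTh⟩ := hint
  refine ⟨max T₀ Th, fun T hT => ?_⟩
  have hT0 : T₀ < T := lt_of_le_of_lt (le_max_left _ _) hT
  have hTh' : Th < T := lt_of_le_of_lt (le_max_right _ _) hT
  have hTpos : 0 < T := pos_of_gt hT
  have hTpos' : 0 < (T : ℝ) := hTpos
  -- B1_two's two binders
  have hsum : ∀ x : (quasiSplit F E c 2).Adelic, Summable fun γ : cl ⁻¹' {i} =>
      f (x⁻¹ * (((γ : cl ⁻¹' {i}) : (quasiSplit F E c 2).arithmeticSubgroup) : (quasiSplit F E c 2).Adelic) * x) :=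
    fun x => (summable_kernel_of_hasCompactSupport hf x x).subtype _
  have hint' := hTh T hTh' (hT₀ T hT0)
  -- `N(𝔸_F)` closed: second countable, locally compact, `ν` s-finite (as in ★ B1_two)
  have hNcl : IsClosed ((adelicUnipotent F E c 2 : Set (quasiSplit F E c 2).Adelic)) := by
    change IsClosed (⇑(adelicVal F E c 2 ((StdForm.antidiagonal 2).over E)) ⁻¹'
      ((upperUnitriangular (Fin 2) (AdeleRing (𝓞 E) E) : Subgroup (GL (Fin 2) (AdeleRing (𝓞 E) E))) :
        Set (GL (Fin 2) (AdeleRing (𝓞 E) E))))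
    exact (isClosed_upperUnitriangular (R := AdeleRing (𝓞 E) E)).preimage continuous_subtype_val
  haveI : SecondCountableTopology (adelicUnipotent F E c 2) := TopologicalSpace.Subtype.secondCountableTopology _
  haveI : LocallyCompactSpace (adelicUnipotent F E c 2) := hNcl.locallyCompactSpace
  haveI : SFinite ν := inferInstance
  -- group → torus on the bracket, then the push with the GLOBAL constants
  obtain ⟨-, hCG⟩ := hB β hβ _ (measurable_bracket_two ν 𝓕 T hfc i)
    (fun n y => bracket_unipotent_mul_two ζ hz₁ hclN ν h𝓕 T hfc hf hcl n y)
    (fun b hb y => bracket_rational_borel_mul_two ζ hc hc1 hz₁ hclN ν h𝓕 T hfc hf i b hb y) hint'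
  rw [truncatedTraceClass_central_eq_add_mul_integral_two ζ hc hc1 hz₁ hcl hclN ν h𝓕 hTpos hfc hf μ νG hβ hsum hint', hCG,
    hpush h𝓕F hwT hφ hH₁ V₀ hΘ T hTpos', Real.log_div (ne_of_gt hTpos') (ne_of_gt hH₁)]
  push_cast
  ring

end UnitaryGroup

end Literature.NumberTheory.Automorphic
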